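import Summits.QuantumAdvantage.QuantumAdvantage.Theorems.SparsityDialMP1

/-!
# SparsityDial — part MP2 of 10 of the «MovingPointers» package (decomp-qadv lens 2, g18): §T3–§T5 joint cells on a hash fibre; twin-pointer loss theorem `TwinAffinePointerLoss3` (PROVED)

Imports its predecessor `SparsityDialMP1` (linear chain MP1 → … → MP10); the package overview is the module docstring of `SparsityDialMP1`.
No `sorry`; standard axioms; no instances / notation.
-/

set_option linter.unusedVariables false
set_option linter.dupNamespace false

noncomputable section
open scoped Classical

namespace Summit.QuantumAdvantage.QuantumAdvantage.Theorems.SparsityDial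

open Finset
open Literature.Computability.QuantumComplexity Literature.Computability.QuantumComplexity.RingHLF
open Literature.Computability.MetaComplexity Literature.Computability.MetaComplexity.Smolensky
open Summit.QuantumAdvantage.AdviceFreeQNC0
open Summit.QuantumAdvantage.QuantumAdvantage.Theorems.HolonomyDial (gCond)
open Summit.QuantumAdvantage.QuantumAdvantage.Theorems.LocusDial
open Summit.QuantumAdvantage.QuantumAdvantage.Theorems.AnchorDial (dev outB win_iff card_odd_ge)
open Summit.QuantumAdvantage.QuantumAdvantage.Theorems.HolonomyDial (card_odd_le)
open Summit.QuantumAdvantage.QuantumAdvantage.Theorems.StabilizerDial (eventually_polylog StabFew stabFew_of_fewLocus)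

/-! ## §T3  Joint cells of two kernel phases on a hash fibre -/

section Fibre
variable {N t : ℕ}

/-- the doubly twisted fibre sum `Σ_{x ∈ fib} χ(α(φ_{k₁} − a) + β(φ_{k₂} − b))`. -/
def fibSum2 (M : Fin t → Fin N → ZMod 3) (v : Fin t → ZMod 3) (α β a b : ZMod 3) (k₁ k₂ : ℕ) : ℂ :=
  ∑ x ∈ fib M v, χ (α * (kph x k₁ - a) + β * (kph x k₂ - b))

/-- SparsityDial «MovingPointers» helper `kph_expand'` (decomp-qadv lens-2 g18 land package; see the module docstring). -/
theorem kph_expand' (x : Fin N → Bool) (k : ℕ) (α a : ZMod 3) :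
    α * (kph x k - a) = α * (((Wk x k : ℕ) : ZMod 3) + ((Wk x (N - 1) : ℕ) : ZMod 3)) +
      (α * ((k + N : ℕ) : ZMod 3) - α * a) := by
  unfold kph
  push_cast
  ring

/-- the doubly twisted fibre sum, Fourier-expanded over the hash. -/
theorem fibSum2_expand (M : Fin t → Fin N → ZMod 3) (v : Fin t → ZMod 3) (α β a b : ZMod 3) (k₁ k₂ : ℕ) :
    (3 : ℂ) ^ t * fibSum2 M v α β a b k₁ k₂ = ∑ lam : Fin t → ZMod 3,
      (∑ x ∈ (univ : Finset (Fin N → Bool)).filter (fun x => OddZeros x),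
        χ ((∑ i : Fin N, (∑ s : Fin t, lam s * M s i) * (if x i then 1 else 0)) +
          α * (((Wk x k₁ : ℕ) : ZMod 3) + ((Wk x (N - 1) : ℕ) : ZMod 3)) +
          β * (((Wk x k₂ : ℕ) : ZMod 3) + ((Wk x (N - 1) : ℕ) : ZMod 3)))) *
      χ ((α * ((k₁ + N : ℕ) : ZMod 3) - α * a) + (β * ((k₂ + N : ℕ) : ZMod 3) - β * b) -
        ∑ s : Fin t, lam s * v s) := by
  unfold fibSum2 fib
  rw [sum_filter, mul_sum]
  have hpt : ∀ x : Fin N → Bool,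
      (3 : ℂ) ^ t * (if linHash M x = v then χ (α * (kph x k₁ - a) + β * (kph x k₂ - b)) else 0) =
      ∑ lam : Fin t → ZMod 3,
        χ ((∑ i : Fin N, (∑ s : Fin t, lam s * M s i) * (if x i then 1 else 0)) +
          α * (((Wk x k₁ : ℕ) : ZMod 3) + ((Wk x (N - 1) : ℕ) : ZMod 3)) +
          β * (((Wk x k₂ : ℕ) : ZMod 3) + ((Wk x (N - 1) : ℕ) : ZMod 3))) *
        χ ((α * ((k₁ + N : ℕ) : ZMod 3) - α * a) + (β * ((k₂ + N : ℕ) : ZMod 3) - β * b) -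
          ∑ s : Fin t, lam s * v s) := by
    intro x
    have e : (if linHash M x = v then χ (α * (kph x k₁ - a) + β * (kph x k₂ - b)) else 0) =
        (if linHash M x = v then (1 : ℂ) else 0) * χ (α * (kph x k₁ - a) + β * (kph x k₂ - b)) := by
      split_ifs <;> simp
    rw [e, ← mul_assoc, fibre_indicator, sum_mul]
    apply sum_congr rfl
    intro lam _
    rw [← χ_add, ← χ_add, lam_hash, kph_expand' x k₁ α a, kph_expand' x k₂ β b]
    ring_nf
  simp_rw [hpt]
  rw [sum_comm]
  apply sum_congr rfl
  intro lam _
  rw [sum_mul]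

/-- **doubly twisted fibre bound**: `432·3^t·‖fibSum2‖ ≤ 2^N` for `(α,β) ≠ 0` (`8(t+3) + 20 ≤ j`). -/
theorem fibSum2_bound (M : Fin t → Fin N → ZMod 3) (v : Fin t → ZMod 3) (α β a b : ZMod 3)
    (hαβ : ¬ (α = 0 ∧ β = 0)) (k₁ k₂ j : ℕ) (h1 : 2 * j ≤ k₁) (h2 : k₁ + 2 * j ≤ k₂) (h3 : k₂ + 1 ≤ N)
    (hjt : 8 * (t + 3) + 20 ≤ j) : (432 : ℝ) * 3 ^ t * ‖fibSum2 M v α β a b k₁ k₂‖ ≤ 2 ^ N := by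
  have hexp := fibSum2_expand M v α β a b k₁ k₂
  have hnorm : (3 : ℝ) ^ t * ‖fibSum2 M v α β a b k₁ k₂‖ ≤ ∑ lam : Fin t → ZMod 3,
      ‖∑ x ∈ (univ : Finset (Fin N → Bool)).filter (fun x => OddZeros x),
        χ ((∑ i : Fin N, (∑ s : Fin t, lam s * M s i) * (if x i then 1 else 0)) +
          α * (((Wk x k₁ : ℕ) : ZMod 3) + ((Wk x (N - 1) : ℕ) : ZMod 3)) +
          β * (((Wk x k₂ : ℕ) : ZMod 3) + ((Wk x (N - 1) : ℕ) : ZMod 3)))‖ := by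
    have e3 : ‖(3 : ℂ) ^ t * fibSum2 M v α β a b k₁ k₂‖ = (3 : ℝ) ^ t * ‖fibSum2 M v α β a b k₁ k₂‖ := by
      rw [norm_mul, norm_pow]
      simp
    rw [← e3, hexp]
    refine (norm_sum_le _ _).trans ?_
    apply sum_le_sum
    intro lam _
    rw [norm_mul, norm_χ, mul_one]
  have hper : ∀ lam : Fin t → ZMod 3, (16 : ℝ) * 3 ^ (t + 3) *
      ‖∑ x ∈ (univ : Finset (Fin N → Bool)).filter (fun x => OddZeros x),
        χ ((∑ i : Fin N, (∑ s : Fin t, lam s * M s i) * (if x i then 1 else 0)) +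
          α * (((Wk x k₁ : ℕ) : ZMod 3) + ((Wk x (N - 1) : ℕ) : ZMod 3)) +
          β * (((Wk x k₂ : ℕ) : ZMod 3) + ((Wk x (N - 1) : ℕ) : ZMod 3)))‖ ≤ 2 ^ N :=
    fun lam => norm_appSum2_le (fun i => ∑ s : Fin t, lam s * M s i) α β hαβ k₁ k₂ j (t + 3) h1 h2 h3 hjt
  have hsum := sum_le_sum (fun lam (_ : lam ∈ (univ : Finset (Fin t → ZMod 3))) => hper lam)
  rw [← mul_sum, sum_const, card_univ, Fintype.card_fun, ZMod.card, Fintype.card_fin, nsmul_eq_mul] at hsum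
  push_cast at hsum
  have h3pos : (0 : ℝ) < 3 ^ t := by positivity
  have e27 : (3 : ℝ) ^ (t + 3) = 27 * 3 ^ t := by rw [pow_add]; norm_num; ring
  rw [e27] at hsum
  nlinarith [hnorm, hsum, norm_nonneg (fibSum2 M v α β a b k₁ k₂)]

/-- **two-variable orthogonality on a fibre**: `9·#{x ∈ fib : φ_{k₁} = a ∧ φ_{k₂} = b} = Σ_{α,β} fibSum2`. -/
theorem cell_count (M : Fin t → Fin N → ZMod 3) (v : Fin t → ZMod 3) (a b : ZMod 3) (k₁ k₂ : ℕ) :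
    (((9 * ((fib M v).filter (fun x => kph x k₁ = a ∧ kph x k₂ = b)).card : ℕ)) : ℂ) =
      ∑ α : ZMod 3, ∑ β : ZMod 3, fibSum2 M v α β a b k₁ k₂ := by
  have hpt : ∀ x : Fin N → Bool, ∑ α : ZMod 3, ∑ β : ZMod 3, χ (α * (kph x k₁ - a) + β * (kph x k₂ - b)) =
      if (kph x k₁ = a ∧ kph x k₂ = b) then (9 : ℂ) else 0 := by
    intro x
    have e : ∑ α : ZMod 3, ∑ β : ZMod 3, χ (α * (kph x k₁ - a) + β * (kph x k₂ - b)) =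
        (∑ α : ZMod 3, χ (α * (kph x k₁ - a))) * (∑ β : ZMod 3, χ (β * (kph x k₂ - b))) := by
      rw [sum_mul]
      apply sum_congr rfl; intro α _
      rw [mul_sum]
      apply sum_congr rfl; intro β _
      rw [χ_add]
    rw [e, sum_χ_mul, sum_χ_mul]
    simp only [sub_eq_zero]
    by_cases h₁ : kph x k₁ = a <;> by_cases h₂ : kph x k₂ = b <;> simp [h₁, h₂]
    all_goals norm_num
  have lhs : (((9 * ((fib M v).filter (fun x => kph x k₁ = a ∧ kph x k₂ = b)).card : ℕ)) : ℂ) =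
      ∑ x ∈ fib M v, (if (kph x k₁ = a ∧ kph x k₂ = b) then (9 : ℂ) else 0) := by
    rw [sum_ite, sum_const_zero, add_zero, sum_const, nsmul_eq_mul]
    push_cast
    ring
  rw [lhs, sum_congr rfl (fun x _ => (hpt x).symm)]
  unfold fibSum2
  rw [sum_comm]
  exact sum_congr rfl (fun α _ => sum_comm)

/-- SparsityDial «MovingPointers» helper `fibSum2_zero` (decomp-qadv lens-2 g18 land package; see the module docstring). -/
theorem fibSum2_zero (M : Fin t → Fin N → ZMod 3) (v : Fin t → ZMod 3) (a b : ZMod 3) (k₁ k₂ : ℕ) :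
    fibSum2 M v 0 0 a b k₁ k₂ = ((fib M v).card : ℂ) := by
  unfold fibSum2
  simp [χ_zero]

/-- every joint cell holds at least `#fib/9 − (8/9)·B` of a fibre once all eight twisted sums are `≤ B`. -/
theorem cell_ge (M : Fin t → Fin N → ZMod 3) (v : Fin t → ZMod 3) (a b : ZMod 3) (k₁ k₂ : ℕ) (B : ℝ)
    (hB : ∀ α β : ZMod 3, ¬ (α = 0 ∧ β = 0) → ‖fibSum2 M v α β a b k₁ k₂‖ ≤ B) :
    ((fib M v).card : ℝ) ≤ 9 * ((fib M v).filter (fun x => kph x k₁ = a ∧ kph x k₂ = b)).card + 8 * B := by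
  have hc := cell_count M v a b k₁ k₂
  set F : ZMod 3 × ZMod 3 → ℂ := fun p => fibSum2 M v p.1 p.2 a b k₁ k₂ with hF
  have hprod : ∑ α : ZMod 3, ∑ β : ZMod 3, fibSum2 M v α β a b k₁ k₂ = ∑ p : ZMod 3 × ZMod 3, F p := by
    rw [← Fintype.sum_prod_type']
  have hsplit : ∑ p : ZMod 3 × ZMod 3, F p = F (0, 0) + ∑ p ∈ (univ : Finset (ZMod 3 × ZMod 3)).erase (0, 0), F p :=
    (add_sum_erase _ F (mem_univ _)).symm
  have hF0 : F (0, 0) = ((fib M v).card : ℂ) := fibSum2_zero M v a b k₁ k₂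
  have hcard : ((univ : Finset (ZMod 3 × ZMod 3)).erase (0, 0)).card = 8 := by
    rw [card_erase_of_mem (mem_univ _), card_univ, Fintype.card_prod, ZMod.card]
  have hrest : ‖∑ p ∈ (univ : Finset (ZMod 3 × ZMod 3)).erase (0, 0), F p‖ ≤ 8 * B := by
    refine (norm_sum_le _ _).trans ?_
    have hle : ∀ p ∈ (univ : Finset (ZMod 3 × ZMod 3)).erase (0, 0), ‖F p‖ ≤ B := by
      intro p hp
      have hne : p ≠ (0, 0) := ne_of_mem_erase hp
      apply hB
      rintro ⟨h0, h0'⟩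
      exact hne (Prod.ext h0 h0')
    have := sum_le_sum hle
    rw [sum_const, hcard, nsmul_eq_mul] at this
    push_cast at this
    linarith
  -- #fib = 9·#cell − rest
  have e : ((fib M v).card : ℂ) =
      (((9 * ((fib M v).filter (fun x => kph x k₁ = a ∧ kph x k₂ = b)).card : ℕ)) : ℂ) -
        ∑ p ∈ (univ : Finset (ZMod 3 × ZMod 3)).erase (0, 0), F p := by
    rw [hc, hprod, hsplit, hF0]; ring
  have hn : ‖((fib M v).card : ℂ)‖ ≤
      ‖(((9 * ((fib M v).filter (fun x => kph x k₁ = a ∧ kph x k₂ = b)).card : ℕ)) : ℂ)‖ +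
        ‖∑ p ∈ (univ : Finset (ZMod 3 × ZMod 3)).erase (0, 0), F p‖ := by
    rw [e]; exact norm_sub_le _ _
  rw [Complex.norm_natCast, Complex.norm_natCast] at hn
  push_cast at hn
  linarith

end Fibre

/-! ## §T4  Counting the losers: five of the nine joint cells -/

section Count
variable {N t : ℕ}

/-- on every fibre the LOSING cells `φ_{k₁} = 2 ⟺ φ_{k₂} = 2` (five of nine) carry `≥ 5/9·#fib − (40/9)·B`. -/
theorem fibre_losers_ge (M : Fin t → Fin N → ZMod 3) (v : Fin t → ZMod 3) (k₁ k₂ : ℕ) (B : ℝ)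
    (hB : ∀ α β a b : ZMod 3, ¬ (α = 0 ∧ β = 0) → ‖fibSum2 M v α β a b k₁ k₂‖ ≤ B) :
    5 * ((fib M v).card : ℝ) ≤
      9 * ((fib M v).filter (fun x => (kph x k₁ = 2 ↔ kph x k₂ = 2))).card + 40 * B := by
  set Lf := (fib M v).filter (fun x => (kph x k₁ = 2 ↔ kph x k₂ = 2)) with hLf
  set T5 : Finset (ZMod 3 × ZMod 3) := univ.filter (fun p => (p.1 = 2 ↔ p.2 = 2)) with hT5def
  have hT5 : T5.card = 5 := by rw [hT5def]; decide
  have hfib : Lf.card = ∑ p ∈ T5, ((fib M v).filter (fun x => kph x k₁ = p.1 ∧ kph x k₂ = p.2)).card := by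
    rw [card_eq_sum_card_fiberwise (f := fun x => (kph x k₁, kph x k₂)) (s := Lf) (t := T5) ?_]
    · apply sum_congr rfl
      rintro ⟨a, b⟩ hp
      have hp' : (a = 2 ↔ b = 2) := by
        rw [hT5def] at hp; simpa using hp
      congr 1
      ext x
      simp only [hLf, mem_filter, Prod.mk.injEq]
      constructor
      · rintro ⟨⟨hx, _⟩, h1, h2⟩
        exact ⟨hx, h1, h2⟩
      · rintro ⟨hx, h1, h2⟩
        exact ⟨⟨hx, by rw [h1, h2]; exact hp'⟩, h1, h2⟩
    · intro x hx
      rw [hLf, coe_filter] at hx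
      rw [hT5def, coe_filter]
      exact ⟨mem_univ _, hx.2⟩
  have hcell : ∀ p ∈ T5, ((fib M v).card : ℝ) ≤
      9 * (((fib M v).filter (fun x => kph x k₁ = p.1 ∧ kph x k₂ = p.2)).card : ℝ) + 8 * B :=
    fun p _ => cell_ge M v p.1 p.2 k₁ k₂ B (fun α β h => hB α β p.1 p.2 h)
  have hs := sum_le_sum hcell
  have e1 : ∑ p ∈ T5, ((fib M v).card : ℝ) = 5 * (fib M v).card := by
    rw [sum_const, hT5, nsmul_eq_mul]; norm_num
  have e2 : ∑ p ∈ T5, (9 * (((fib M v).filter (fun x => kph x k₁ = p.1 ∧ kph x k₂ = p.2)).card : ℝ) + 8 * B) =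
      9 * ∑ p ∈ T5, (((fib M v).filter (fun x => kph x k₁ = p.1 ∧ kph x k₂ = p.2)).card : ℝ) + 40 * B := by
    rw [sum_add_distrib, ← mul_sum, sum_const, hT5, nsmul_eq_mul]; ring
  rw [e1, e2] at hs
  rw [hfib]
  push_cast
  linarith

/-- **global count**: `5·#odd ≤ 9·#{odd : φ_{π₁} = 2 ⟺ φ_{π₂} = 2} + (40/432)·2^N`. -/
theorem twin_losers_ge (M : Fin t → Fin N → ZMod 3) (π₁ π₂ : (Fin t → ZMod 3) → ℕ) (j : ℕ)
    (hsep : ∀ v, 2 * j ≤ π₁ v ∧ π₁ v + 2 * j ≤ π₂ v ∧ π₂ v + 1 ≤ N) (hjt : 8 * (t + 3) + 20 ≤ j) :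
    5 * ((univ.filter fun x : Fin N → Bool => OddZeros x).card : ℝ) ≤
      9 * ((univ.filter fun x : Fin N → Bool => OddZeros x ∧
        (kph x (π₁ (linHash M x)) = 2 ↔ kph x (π₂ (linHash M x)) = 2)).card : ℝ) + 40 * 2 ^ N / 432 := by
  set Odd := (univ : Finset (Fin N → Bool)).filter (fun x => OddZeros x) with hOdd
  set L := univ.filter fun x : Fin N → Bool => OddZeros x ∧
        (kph x (π₁ (linHash M x)) = 2 ↔ kph x (π₂ (linHash M x)) = 2) with hL
  have hOdd_fib : Odd.card = ∑ v : Fin t → ZMod 3, (fib M v).card := by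
    rw [card_eq_sum_card_fiberwise (f := fun x => linHash M x) (t := (univ : Finset (Fin t → ZMod 3)))
      (fun x _ => mem_univ _)]
    rfl
  have hL_fib : L.card = ∑ v : Fin t → ZMod 3,
      ((fib M v).filter (fun x => (kph x (π₁ v) = 2 ↔ kph x (π₂ v) = 2))).card := by
    rw [card_eq_sum_card_fiberwise (f := fun x => linHash M x) (t := (univ : Finset (Fin t → ZMod 3)))
      (fun x _ => mem_univ _)]
    apply sum_congr rfl
    intro v _
    congr 1
    rw [hL]
    unfold fib
    ext x
    simp only [mem_filter, mem_univ, true_and]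
    constructor
    · rintro ⟨⟨hx, hk⟩, hv⟩
      exact ⟨⟨hx, hv⟩, by rw [← hv]; exact hk⟩
    · rintro ⟨⟨hx, hv⟩, hk⟩
      exact ⟨⟨hx, by rw [hv]; exact hk⟩, hv⟩
  have hfib : ∀ v : Fin t → ZMod 3, 5 * ((fib M v).card : ℝ) ≤
      9 * ((fib M v).filter (fun x => (kph x (π₁ v) = 2 ↔ kph x (π₂ v) = 2))).card + 40 * (2 ^ N / (432 * 3 ^ t)) := by
    intro v
    obtain ⟨h1, h2, h3⟩ := hsep v
    apply fibre_losers_ge M v (π₁ v) (π₂ v) (2 ^ N / (432 * 3 ^ t))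
    intro α β a b hαβ
    have hb := fibSum2_bound M v α β a b hαβ (π₁ v) (π₂ v) j h1 h2 h3 hjt
    rw [le_div_iff₀ (by positivity)]
    linarith
  have hs := sum_le_sum (fun v (_ : v ∈ (univ : Finset (Fin t → ZMod 3))) => hfib v)
  rw [← mul_sum, sum_add_distrib, ← mul_sum, sum_const, card_univ, Fintype.card_fun, ZMod.card, Fintype.card_fin,
    nsmul_eq_mul] at hs
  push_cast at hs
  have e : (3 : ℝ) ^ t * (40 * (2 ^ N / (432 * 3 ^ t))) = 40 * 2 ^ N / 432 := by
    field_simp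
  rw [hOdd_fib, hL_fib]
  push_cast
  linarith

end Count

/-! ## §T5  The strategy-level theorem and the packaged rung `TwinAffinePointerLoss3` (PROVED) -/

section Strategy
variable {N t : ℕ}

/-- a strategy deviating at exactly two positions loses iff the two kernel phases agree on `= 2`. -/
theorem lose_iff_of_dev_pair (hN : 3 ≤ N) (P : Fin N → CubeFn (ZMod 3) N) (x : Fin N → Bool) (hx : OddZeros x)
    (k₁ k₂ : Fin N) (hne : k₁ ≠ k₂) (hdev : dev P x = {k₁, k₂}) :
    ¬ Rel x (outB P x) ↔ (kph x k₁.val = 2 ↔ kph x k₂.val = 2) := by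
  rw [win_iff hN P x hx, hdev, filter_insert, filter_singleton]
  simp only [gCond_iff_kph]
  by_cases h1 : kph x k₁.val = 2 <;> by_cases h2 : kph x k₂.val = 2 <;> simp [h1, h2, hne]

/-- **THE TWIN-POINTER LOSS THEOREM**: deviation set `{π₁(L x), π₂(L x)}` for an `𝔽₃`-linear hash `L` with `t`
forms, pointers separated by `2j ≤ π₁`, `π₁ + 2j ≤ π₂`, and `8(t+3) + 20 ≤ j` ⇒ `#odd ≤ 2·#{odd losers}`. -/
theorem twinPointer_loss (hN : 3 ≤ N) (M : Fin t → Fin N → ZMod 3) (π₁ π₂ : (Fin t → ZMod 3) → Fin N) (j : ℕ)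
    (hsep : ∀ v, 2 * j ≤ (π₁ v).val ∧ (π₁ v).val + 2 * j ≤ (π₂ v).val) (hjt : 8 * (t + 3) + 20 ≤ j)
    (P : Fin N → CubeFn (ZMod 3) N)
    (hdev : ∀ x, OddZeros x → dev P x = {π₁ (linHash M x), π₂ (linHash M x)}) :
    (univ.filter fun x : Fin N → Bool => OddZeros x).card ≤
      2 * (univ.filter fun x : Fin N → Bool => OddZeros x ∧ ¬ Rel x (outB P x)).card := by
  have hlos : (univ.filter fun x : Fin N → Bool => OddZeros x ∧ ¬ Rel x (outB P x)) =
      univ.filter fun x : Fin N → Bool => OddZeros x ∧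
        (kph x (π₁ (linHash M x)).val = 2 ↔ kph x (π₂ (linHash M x)).val = 2) := by
    apply filter_congr
    intro x _
    exact and_congr_right (fun hx => lose_iff_of_dev_pair hN P x hx _ _
      (by intro h; have h' := congrArg Fin.val h; have := hsep (linHash M x); omega) (hdev x hx))
  rw [hlos]
  have h5 := twin_losers_ge M (fun v => (π₁ v).val) (fun v => (π₂ v).val) j
    (fun v => ⟨(hsep v).1, (hsep v).2, by have := (π₂ v).isLt; omega⟩) hjt
  set O := (univ.filter fun x : Fin N → Bool => OddZeros x).card with hO
  set L := (univ.filter fun x : Fin N → Bool => OddZeros x ∧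
        (kph x (π₁ (linHash M x)).val = 2 ↔ kph x (π₂ (linHash M x)).val = 2)).card with hL
  have hOge : 2 ^ (N - 1) ≤ O := card_odd_ge (by omega)
  have hOge' : (2 : ℝ) ^ (N - 1) ≤ O := by exact_mod_cast hOge
  have hpow : (2 : ℝ) ^ N = 2 * 2 ^ (N - 1) := by
    rw [← pow_succ']; congr 1; omega
  have h5' : 5 * (O : ℝ) ≤ 9 * (L : ℝ) + 40 * 2 ^ N / 432 := h5
  have hreal : (O : ℝ) ≤ 2 * L := by
    rw [hpow] at h5'
    nlinarith [h5', hOge']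
  exact_mod_cast hreal

/-- **the rung `TwinAffinePointerLoss3`** (format of the tree's `AffinePointerLoss3`, two pointers): every strategy whose
deviation set is `{π₁(L x), π₂(L x)}` for an `𝔽₃`-linear hash `L` with `t ≤ (log₂ n)^c` forms and ANY two lookups with
`n/4 ≤ π₁`, `π₁ + n/4 ≤ π₂` wins on at most `(1 − n^{-C})·2^{n−1}` odd inputs. -/
def TwinAffinePointerLoss3 : Prop := ∃ C : ℕ, ∀ c : ℕ, ∃ n₀ : ℕ, ∀ n ≥ n₀, ∀ t ≤ (Nat.log 2 n) ^ c,
  ∀ (M : Fin t → Fin n → ZMod 3) (π₁ π₂ : (Fin t → ZMod 3) → Fin n),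
    (∀ v, n / 4 ≤ (π₁ v).val ∧ (π₁ v).val + n / 4 ≤ (π₂ v).val) →
    ∀ P : Fin n → CubeFn (ZMod 3) n, (∀ x, OddZeros x → dev P x = {π₁ (linHash M x), π₂ (linHash M x)}) →
      ((univ.filter fun x : Fin n → Bool => OddZeros x ∧ Rel x (fun i => decide (P i x = 1))).card : ℝ) ≤
        (1 - 1 / (n : ℝ) ^ C) * (2 : ℝ) ^ (n - 1)

/-- **`TwinAffinePointerLoss3` PROVED** (`C = 1`). -/
theorem twinAffinePointerLoss3 : TwinAffinePointerLoss3 := by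
  refine ⟨1, fun c => ?_⟩
  obtain ⟨n₀, hn₀⟩ := eventually_polylog 416 c
  refine ⟨n₀, fun n hn t ht M π₁ π₂ hsep P hdev => ?_⟩
  obtain ⟨hK, hL⟩ := hn₀ n hn
  have hLc : 1 ≤ (Nat.log 2 n) ^ c := Nat.one_le_pow _ _ (by omega)
  have hn2 : 64 * t + 352 ≤ n := by
    have := Nat.div_le_self n 2
    nlinarith [ht, hK, hLc, this]
  have h3 : 3 ≤ n := by omega
  have hjt : 8 * (t + 3) + 20 ≤ n / 8 := by omega
  have h2j : 2 * (n / 8) ≤ n / 4 := by omega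
  have hq := twinPointer_loss (N := n) h3 M π₁ π₂ (n / 8)
    (fun v => ⟨le_trans h2j (hsep v).1, by have := (hsep v).2; omega⟩) hjt P hdev
  exact real_loss_of_frac (M := 2) (by norm_num) (by omega) h3 P hq

end Strategy

/-! ## Guards: standard axioms only -/
/-- info: 'Summit.QuantumAdvantage.QuantumAdvantage.Theorems.SparsityDial.twinPointer_loss' depends on axioms: [propext,
 Classical.choice,
 Quot.sound] -/
#guard_msgs in #print axioms twinPointer_loss
/-- info: 'Summit.QuantumAdvantage.QuantumAdvantage.Theorems.SparsityDial.twinAffinePointerLoss3' depends on axioms: [propext,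
 Classical.choice,
 Quot.sound] -/
#guard_msgs in #print axioms twinAffinePointerLoss3
/-- info: 'Summit.QuantumAdvantage.QuantumAdvantage.Theorems.SparsityDial.normSq_trR_le_stretch' depends on axioms: [propext,
 Classical.choice,
 Quot.sound] -/
#guard_msgs in #print axioms normSq_trR_le_stretch


end Summit.QuantumAdvantage.QuantumAdvantage.Theorems.SparsityDial
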